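/-
Copyright (c) 2026 the pub-hodgecm-mathlib formalisation cell (harness21).  Prover seat hodgecm-mathlib-B-p08 (g40): LH4-plan (g6) WORD #65 item (P5a) «A′» — the AFFINE variant of
★ `SelfDualLatticeScalarReductionTransport` §3∕§4 for the wild type-(2) rows (memo `B-provers/B-p08/g40/MEMO-M6-EP-wild.v1.B-p08g40.md` §2(e), §4 row «supplier FILE A»); 2026-09-02.
-/
import Literature.NumberTheory.Automorphic.SelfDualLatticeScalarReductionTransport   -- ★ B-p08 (g28) FILE A: `glIntReduction_val_eq_map`, `subtype_mapMatrix_glIntEquiv_symm`, `residue_mul_residue_eq_one`, `trace∕det_units_inv_mul_mul`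
import HarnessLib

/-!
# The AFFINE monodromy dictionary of a `2 × 2` matrix at an arbitrary centre: `(k − a·1)² = (tr k − 2a)·(k − a·1) − χ_k(a)·1`, and square-nilpotent reduction

Topic `NumberTheory/Automorphic`; namespace `Literature.NumberTheory.Automorphic`.  THEOREMS ONLY (no definition, no instance, no notation, no named fact, no `sorry`);
kernel lane `--supports stmt-HodgeConjecture-24833`.  Cell `pub/hodgecm-mathlib` (D-0151), crux H413 = `stmt-HodgeConjecture-24833`; half A line LH4 (dyadic pay-down),
LH4-plan (g6) price list WORD #40∕#65, item **(P5a) «A′»** = the first supplier brick of the memo «M6 ∕ Euler–Poincaré at a wild type-(2) row» (B-p08 (g40),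
`B-provers/B-p08/g40/MEMO-M6-EP-wild.v1.B-p08g40.md`, §2(e) and §4): the `2 × 2` monodromy dictionary of ★ FILE A `SelfDualLatticeScalarReductionTransport` §3
(`(k − (tr k∕2)·1)² = ((tr² − 4det)∕4)·1`, `sub_smul_one_mul_self_eq_smul_one`) is CENTRED AT `tr k ∕ 2`, which at a WILD unit-discriminant row (`v ∣ 2`, `K₂ = L_w(√(1+w₀))`)
is NOT integral; the AFFINE dictionary below is centred at an ARBITRARY scalar `a` — in the application the `1`-coordinate of the eigenvalue `λ = a + b·Π` in the Eisenstein
frame `(1, Π)` of ★ `LocalFields/WildQuadraticEisensteinFrame` ∕ ★ `NumberFields/RamifiedQuadraticDictionaryWild`, always integral — and its reduction lemma asks only that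
BOTH lower coefficients lie in `𝓂`, which the Eisenstein relation of `b·Π` supplies (`tr − 2a = b(Π + Π′) = −2b∕ϖ^k`, `χ(a) = b²·ΠΠ′ = −b²w₀∕ϖ^{2k}`).  HONEST LABEL: HC_CM
is proved only modulo the 7 printed citations (2 remaining named inputs: hLiu418 = stmt-HodgeConjecture-24832, h413 = stmt-HodgeConjecture-24833) until rung 0 closes; this
file is count-neutral base layer (pays no organ, opens no road).

* §1 (pure `CommRing`, `2 × 2`): **`sub_smul_one_mul_self_eq_affine`** — Cayley–Hamilton at the centre `a`: `(k − a·1)·(k − a·1) = (tr k − 2a)·(k − a·1) − (a² − tr k·a + det k)·1`;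
  **`sub_smul_one_mul_self_eq_affine_of_eigenCoord`** — if `tr k = (a + bΠ) + (a + bΠ′)` and `det k = (a + bΠ)(a + bΠ′)` (the eigenvalues in a frame `(1, Π)`, `Π′` the
  conjugate) then `(k − a·1)² = (b(Π + Π′))·(k − a·1) − (b²ΠΠ′)·1`; over a field, the conjugation-invariant form **`units_inv_mul_mul_sub_smul_one_mul_self_eq_affine`**
  for `g⁻¹ k g` (★ `trace_units_inv_mul_mul`, ★ `det_units_inv_mul_mul`).
* §2 (valued field `F`, `GL_n(𝒪)`): **`glIntReduction_sub_smul_one_sq_eq_zero_of_affine`** — `k ∈ GL_n(𝒪)`, `a, f, e ∈ 𝒪`, `|f| < 1`, `|e| < 1`,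
  `(k − a·1)² = f·(k − a·1) + e·1 ⇒ (k̄ − ā·1)² = 0` in `M_n(𝓀)` (the affine twin of ★ `glIntReduction_sub_smul_one_sq_eq_zero`; same lift-and-reduce proof) — so at every
  type-(2) row, tame or wild, the local monodromy at a fixed vertex is a SCALAR or a TRANSVECTION modulo `𝓂`, the two star types of Kottwitz's edge count [Kottwitz1988, §2].

## References
* [Kottwitz1988] R. E. Kottwitz, *Tamagawa numbers*, Ann. of Math. 127 (1988), 629–646, §2 (Euler–Poincaré functions; fixed edges over fixed vertices).
* [HornJohnson2013] R. A. Horn, C. R. Johnson, *Matrix Analysis*, 2nd ed. (2013), Thm. 2.4.3.2 (Cayley–Hamilton), §1.3 (similarity invariants).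
* [IwahoriMatsumoto1965] N. Iwahori, H. Matsumoto, Publ. Math. IHÉS 25 (1965), §2 (reduction mod `𝔓` on `GL_n(𝒪)`).
* [Serre1979] J.-P. Serre, *Local Fields*, GTM 67 (1979), Ch. I §6 Prop. 18 (Eisenstein equations).
-/

set_option autoImplicit false

noncomputable section

open scoped ValuativeRel Matrix MatrixGroups
open Set Matrix ValuativeRel

namespace Literature.NumberTheory.Automorphic

/-! ## §1 Cayley–Hamilton at an arbitrary centre (`2 × 2`, any commutative ring) -/

section Affine

variable {R : Type*} [CommRing R]

/-- **CAYLEY–HAMILTON AT THE CENTRE `a`**: `(k − a·1)·(k − a·1) = (tr k − 2a)·(k − a·1) − (a² − tr k·a + det k)·1` for every `2 × 2` matrix `k` and every scalar `a`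
(`k² = tr k·k − det k·1`).  At `a = tr k∕2` (when `2` is invertible) this is ★ `sub_smul_one_mul_self_eq_smul_one`. [cite: HornJohnson2013, Thm. 2.4.3.2] [cite: Kottwitz1988, §2] -/
theorem sub_smul_one_mul_self_eq_affine (k : Matrix (Fin 2) (Fin 2) R) (a : R) :
    (k - a • (1 : Matrix (Fin 2) (Fin 2) R)) * (k - a • (1 : Matrix (Fin 2) (Fin 2) R)) =
      (k.trace - 2 * a) • (k - a • (1 : Matrix (Fin 2) (Fin 2) R)) - (a * a - k.trace * a + k.det) • (1 : Matrix (Fin 2) (Fin 2) R) := by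
  rw [Matrix.trace_fin_two, Matrix.det_fin_two]
  ext i j
  fin_cases i <;> fin_cases j <;>
    · simp [Matrix.mul_apply, Fin.sum_univ_two, Matrix.one_apply]
      ring

/-- **THE EIGEN-COORDINATE READING**: if the eigenvalues of `k` are `a + bΠ` and `a + bΠ′` — `tr k = (a + bΠ) + (a + bΠ′)`, `det k = (a + bΠ)(a + bΠ′)` — then
`(k − a·1)² = (b(Π + Π′))·(k − a·1) − (b²·ΠΠ′)·1`: the matrix `k − a·1` satisfies the (Eisenstein) equation of `bΠ`, `X² − b(Π + Π′)X + b²ΠΠ′ = 0`.  In the wild unit-discriminant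
frame `Π = (α − 1)∕ϖ^k`: `Π + Π′ = −2∕ϖ^k`, `ΠΠ′ = −w₀∕ϖ^{2k}` (★ `WildQuadraticEisensteinFrame.wildUniformizer_add_map` ∕ `…_mul_map`). [cite: Serre1979, Ch. I §6 Prop. 18]
[cite: HornJohnson2013, Thm. 2.4.3.2] -/
theorem sub_smul_one_mul_self_eq_affine_of_eigenCoord (k : Matrix (Fin 2) (Fin 2) R) {a b P P' : R}
    (htr : k.trace = (a + b * P) + (a + b * P')) (hdet : k.det = (a + b * P) * (a + b * P')) :
    (k - a • (1 : Matrix (Fin 2) (Fin 2) R)) * (k - a • (1 : Matrix (Fin 2) (Fin 2) R)) =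
      (b * (P + P')) • (k - a • (1 : Matrix (Fin 2) (Fin 2) R)) - (b * b * (P * P')) • (1 : Matrix (Fin 2) (Fin 2) R) := by
  rw [sub_smul_one_mul_self_eq_affine, htr]
  have h1 : (a + b * P) + (a + b * P') - 2 * a = b * (P + P') := by ring
  have h2 : a * a - ((a + b * P) + (a + b * P')) * a + k.det = b * b * (P * P') := by rw [hdet]; ring
  rw [h1, h2]

end Affine

section Field

variable {K : Type*} [Field K]

/-- **CONJUGATION KEEPS THE AFFINE DICTIONARY**: for `g ∈ GL₂`, `(g⁻¹ k g − a·1)² = (tr k − 2a)·(g⁻¹ k g − a·1) − (a² − tr k·a + det k)·1` — the local monodromy at every vertex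
satisfies the SAME affine relation as `k` (★ `trace_units_inv_mul_mul`, ★ `det_units_inv_mul_mul`). [cite: HornJohnson2013, §1.3] [cite: Kottwitz1988, §2] -/
theorem units_inv_mul_mul_sub_smul_one_mul_self_eq_affine (g : GL (Fin 2) K) (k : Matrix (Fin 2) (Fin 2) K) (a : K) :
    (((g⁻¹ : GL (Fin 2) K) : Matrix (Fin 2) (Fin 2) K) * k * (g : Matrix (Fin 2) (Fin 2) K) - a • (1 : Matrix (Fin 2) (Fin 2) K)) *
        (((g⁻¹ : GL (Fin 2) K) : Matrix (Fin 2) (Fin 2) K) * k * (g : Matrix (Fin 2) (Fin 2) K) - a • (1 : Matrix (Fin 2) (Fin 2) K)) =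
      (k.trace - 2 * a) • (((g⁻¹ : GL (Fin 2) K) : Matrix (Fin 2) (Fin 2) K) * k * (g : Matrix (Fin 2) (Fin 2) K) - a • (1 : Matrix (Fin 2) (Fin 2) K)) -
        (a * a - k.trace * a + k.det) • (1 : Matrix (Fin 2) (Fin 2) K) := by
  rw [sub_smul_one_mul_self_eq_affine, trace_units_inv_mul_mul, det_units_inv_mul_mul]

end Field

/-! ## §2 Square-nilpotent reduction from an affine relation with coefficients in `𝓂` -/

section Reduction

variable {F : Type*} [Field F] [ValuativeRel F] {n : ℕ}

/-- **A square-nilpotent reduction, AFFINE form**: if `(k − a·1)² = f·(k − a·1) + e·1` with `k ∈ GL_n(𝒪)`, `a, f, e ∈ 𝒪`, `|f| < 1`, `|e| < 1`, then `(k̄ − ā·1)² = 0` in `M_n(𝓀)`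
(`f̄ = ē = 0`).  The affine twin of ★ `glIntReduction_sub_smul_one_sq_eq_zero` (`f = 0`); at a wild type-(2) row `f = −2b∕ϖ^k`, `e = b²w₀∕ϖ^{2k}` both lie in `𝓂_w` (memo §2(e)), so the
local monodromy reduces to a scalar or a transvection exactly as in the tame case. [cite: IwahoriMatsumoto1965, §2] [cite: Kottwitz1988, §2] -/
theorem glIntReduction_sub_smul_one_sq_eq_zero_of_affine (k : glInt n F) (a f e : 𝒪[F]) (hf : valuation F (f : F) < 1) (he : valuation F (e : F) < 1)
    (hk : (((k : GL (Fin n) F) : Matrix (Fin n) (Fin n) F) - (a : F) • (1 : Matrix (Fin n) (Fin n) F)) *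
        (((k : GL (Fin n) F) : Matrix (Fin n) (Fin n) F) - (a : F) • (1 : Matrix (Fin n) (Fin n) F)) =
          (f : F) • (((k : GL (Fin n) F) : Matrix (Fin n) (Fin n) F) - (a : F) • (1 : Matrix (Fin n) (Fin n) F)) + (e : F) • (1 : Matrix (Fin n) (Fin n) F)) :
    (((glIntReduction n F k : GL (Fin n) 𝓀[F]) : Matrix (Fin n) (Fin n) 𝓀[F]) - IsLocalRing.residue 𝒪[F] a • (1 : Matrix (Fin n) (Fin n) 𝓀[F])) *
        (((glIntReduction n F k : GL (Fin n) 𝓀[F]) : Matrix (Fin n) (Fin n) 𝓀[F]) - IsLocalRing.residue 𝒪[F] a • (1 : Matrix (Fin n) (Fin n) 𝓀[F])) = 0 := by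
  -- lift the identity to `M_n(𝒪)` along the injective `subtype.mapMatrix`
  set kO : Matrix (Fin n) (Fin n) 𝒪[F] := (((glIntEquiv n F).symm k : GL (Fin n) 𝒪[F]) : Matrix (Fin n) (Fin n) 𝒪[F]) with hkO
  have hinj : Function.Injective ((𝒪[F]).subtype.mapMatrix : Matrix (Fin n) (Fin n) 𝒪[F] →+* Matrix (Fin n) (Fin n) F) := fun M N h =>
    Matrix.ext fun i j => Subtype.ext (by simpa [RingHom.mapMatrix_apply] using congrFun (congrFun h i) j)
  have h1 : (𝒪[F]).subtype.mapMatrix (kO - a • (1 : Matrix (Fin n) (Fin n) 𝒪[F])) = ((k : GL (Fin n) F) : Matrix (Fin n) (Fin n) F) - (a : F) • (1 : Matrix (Fin n) (Fin n) F) := by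
    rw [map_sub, subtype_mapMatrix_glIntEquiv_symm]
    congr 1
    ext i j
    by_cases hij : i = j <;> simp [RingHom.mapMatrix_apply, Matrix.map_apply, Matrix.smul_apply, hij]
  have hsmul : ∀ (c : 𝒪[F]) (M : Matrix (Fin n) (Fin n) 𝒪[F]), (𝒪[F]).subtype.mapMatrix (c • M) = (c : F) • (𝒪[F]).subtype.mapMatrix M := fun c M => by
    ext i j
    simp [RingHom.mapMatrix_apply, Matrix.map_apply, Matrix.smul_apply]
  have h2 : (𝒪[F]).subtype.mapMatrix (e • (1 : Matrix (Fin n) (Fin n) 𝒪[F])) = (e : F) • (1 : Matrix (Fin n) (Fin n) F) := by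
    rw [hsmul, map_one]
  have hO : (kO - a • (1 : Matrix (Fin n) (Fin n) 𝒪[F])) * (kO - a • (1 : Matrix (Fin n) (Fin n) 𝒪[F])) =
      f • (kO - a • (1 : Matrix (Fin n) (Fin n) 𝒪[F])) + e • (1 : Matrix (Fin n) (Fin n) 𝒪[F]) := by
    apply hinj
    rw [map_mul, map_add, hsmul, h1, h2, hk]
  -- reduce: `f̄ = ē = 0`
  have hred := congrArg ((IsLocalRing.residue 𝒪[F]).mapMatrix) hO
  rw [map_mul, map_add, map_sub] at hred
  have h3 : (IsLocalRing.residue 𝒪[F]).mapMatrix (a • (1 : Matrix (Fin n) (Fin n) 𝒪[F])) = IsLocalRing.residue 𝒪[F] a • (1 : Matrix (Fin n) (Fin n) 𝓀[F]) := by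
    ext i j
    by_cases hij : i = j
    · subst hij; simp [RingHom.mapMatrix_apply, Matrix.map_apply]
    · simp [RingHom.mapMatrix_apply, Matrix.map_apply, Matrix.one_apply_ne hij]
  have hzero : ∀ (c : 𝒪[F]) (M : Matrix (Fin n) (Fin n) 𝒪[F]), valuation F (c : F) < 1 → (IsLocalRing.residue 𝒪[F]).mapMatrix (c • M) = 0 := fun c M hc => by
    have hc0 : IsLocalRing.residue 𝒪[F] c = 0 := residue_eq_zero_of_valuation_lt_one hc
    ext i j
    rw [RingHom.mapMatrix_apply, Matrix.map_apply, Matrix.smul_apply, smul_eq_mul, map_mul, hc0, zero_mul, Matrix.zero_apply]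
  rw [h3, hzero f _ hf, hzero e _ he, zero_add, ← glIntReduction_val_eq_map] at hred
  exact hred

end Reduction

end Literature.NumberTheory.Automorphic

end
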